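import Summits.QuantumFields.YangMills.Theorems.IR.AfPincerUcFormat
import Summits.QuantumFields.YangMills.Theorems.IR.TelescopedCodingCompose
import Summits.QuantumFields.YangMills.Theorems.IR.HaarCodingClusteringSeq
import Literature.RepresentationTheory.CompactGroups.UnitaryTrick

/-!
# Line `telescoped-coding` — crux `BalabanLadder.IR` (stmt-QuantumFields-19354), ideator `ym-ir-idea-4` g0
# (lens: certified interpolation cluster-region → small-field region; cell pub/ym-ir, R350 B3)

v2.1 (pooled prover ym-ir-line-pool-p3, 2026-08-28T02:35Z): §1 vocabulary moved to tree constants (`Theorems/IR/TelescopedCodingDefs.lean`, p596243);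
STUB C2 `stub_composeCoders` is PROVED in the tree — `Theorems/IR/TelescopedCodingCompose.lean`, `composeCoders_holds` (c = 2(b₁+b₂)+1,
K = max K₂ 0 + 1536(4b₂+3)⁴ max K₁ 0; parts `TelescopedCodingNoiseSplit` p596972, `TelescopedCodingBlocks` p597315) — and is closed below by it
(no `sorry`); STUB E `stub_codedClustering` is closed by bsf-p1's `HaarCodingEngine.codedClusteringSeq` (`Theorems/IR/HaarCodingClusteringSeq.lean`,
definitional unfolding of the two identical vocabularies).  Remaining sorries: C3, T, U_UV, U_×, X (+ the typed rung).

BAŁABAN'S BLOCK RG READ AS A TRIANGULAR TRANSPORT.  A coder of the BLOCK-HOLONOMY field at block side `M`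
(«coarse coder», input radius `O(b₁)` blocks) composed with a CONDITIONAL coder of the fine field given its
block holonomies («conditional coder», input radius `O(b₂)` blocks) is a coder of the fine Wilson measure at
radius `O(M)` — radii ADD, tails stay exponential, constants stay uniform (stub C2, provable now).  The lens's
two regions become two stubs: the CLUSTER REGION is the statement that for all large `β` the block field at
SOME scale `M(β)` is coded with `O(1)`-block radius (stub T: the effective theory at the confinement scale is
disordered in the strongest — finitary-factor — sense; no renormalised Hamiltonian is needed, so the
non-Gibbsianity of RG images is moot); the SMALL-FIELD + CROSSOVER region is the statement that WHENEVER the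
block field at scale `M` is `O(1)`-block-coded, the fine field given the blocks is coded at radius `O(M)`
(stub U: Bałaban's constrained small-field fluctuation measures are close to log-concave ⇒ local conditional
transport à la Caffarelli ∕ Kim–Milman ∕ Bauerschmidt–Bodineau; large fields are the coding's exceptional
events; the hypothesis forces `M ≳ ξ/b₁`, so U never asks for the unconditional infrared statement).

NOISE ALPHABET.  Here the noise is an i.i.d. SEQUENCE of Haar variables per link (index `ℕ × Edge`), so that a
composite coder can feed disjoint sub-sequences to its two stages without a measure-isomorphism theorem; a
coder from one Haar variable per link (format `HaarCoded` of line `haar-coding`) is a coder from sequences by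
reading coordinate `0`, so every stub below is implied by its `haar-coding` namesake and the two engines ∕ two
AF stubs have the same proofs.

v2 (2026-08-28T00:30Z, after ym-ir-crit-1's verdict (b) «split U»).  CHANGES: (i) `blockField` is now SEAM-EXACT on odd tori
(blocks of the fundamental domain `[0,N)⁴` truncated at its edge instead of wrapped periodic lines), so that dyadic blocks
NEST exactly (`2^{j'} ∣ 2^{j}` ⇒ the `2^j`-block field is a fixed local function of the `2^{j'}`-block field) — needed for the
exactness of conditional composition; (ii) scales are DYADIC and U is stated relative to the MINIMAL coded dyadic scale
`jStar` (else «a factor below a coded scale» could still be far above `ξ`); (iii) U is SPLIT: `stub_deepSmallFieldCondCoder`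
(U_UV: fine field given its `2^{j'}`-blocks for `j' ≤ jStar − λ`, a fixed number `λ(G,r,K₁,b₁)` of octaves BELOW the minimal
disordered scale — deep small field, supplier class = Bałaban's conditional small-field RG, R4 machinery one level down)
+ `stub_crossoverCondBlockCoder` (U_×: the `2^{j'}`-block field GIVEN the `2^{jStar}`-block field across those last `λ`
octaves — the crossover wall, CONDITIONAL) + `stub_composeCond` (C3, provable: conditional coders compose along nested
blocks); the old un-split `stub_smallFieldCondCoder` is retired (it is implied by U_UV ∧ U_× ∧ C3 at `j = jStar`).

STUBS (seven, the maximum; v1 had five): `stub_codedClustering` (E, engine, M, provable), `stub_composeCoders` (C2, M–L,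
provable: union bound over the `≤ 4(2kb₂+2)⁴` blocks meeting an input ball + a.s. block-constancy of the coarse
output + independence of the two noise halves), `stub_clusterRegionCoder` (T, research XL: the infrared end of
the wall), `stub_smallFieldCondCoder` (U, research XL: the small-field∕crossover end, CONDITIONAL), `stub_codedAF`
(X, research L–XL: AF up to the coding onset, verbatim shape of `fmtOnset_pinned`'s `hX`).
`irCal_of_telescoped : E → C2 → C3 → T → U_UV → U_× → X → AfPincerUc.IRCal` is a real proof; `IR_of_stubs` concludes
`Summit.QuantumFields.YangMills.Theses.BalabanLadder.IR` BY NAME; `sorry` only inside `stub_*`.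

HONESTY.  Nothing here proves the Clay Yang–Mills mass gap; the route's `closes` is conditional on
`BalabanLadder.UV ∧ NT ∧ IR`, R4 of the ladder concerns the finite-𝕋⁴ rung `BalabanLadder.UV` only, and this
file proves no stub.
-/

set_option autoImplicit false

noncomputable section

open Filter Topology MeasureTheory
open scoped SchwartzMap
open Literature.MathematicalPhysics.QuantumFieldTheory Literature.MathematicalPhysics.QuantumLattice
open Summit.QuantumFields.YangMills.Cruxes.OSLegsFromFemtoAndGap.DlrCollarTransfer (GapInUnits LowerBounds Q2)
open Summit.QuantumFields.YangMills.Cruxes.IR.AfPincerUc (fmtSet fmtOnset FmtClustering fmtOnset_pinned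
  gapInUnits_of_fmtOnset)

namespace Summit.QuantumFields.YangMills.Cruxes.IR.TelescopedCoding

/-! ## §1 Objects — NOW TREE CONSTANTS: `supDist`, `inputBall`, `Noise`, `seqNoise`, `edgeRep`, `blockField`, `HaarCodedSeq`,
`CoarseCodedSeq`, `CondCodedSeq`, `CondBlockCodedSeq`, `jStar` live VERBATIM in `Theorems/IR/TelescopedCodingDefs.lean` (p596243, pooled prover
ym-ir-line-pool-p3, 2026-08-28) and are imported above; this file keeps the registered stubs and the compositions only. -/


/-! ## §2 Five REGISTERED stubs -/

/-- stub E (ENGINE, M — provable now, group-blind; same proof as `HaarCoding.stub_codedClustering`): **Haar-coded ⇒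
clustering** at rate `1/(4b)` per lattice site on tori of side `≥ 4b`, constant depending on the species and `K` only:
cylinder observables become, off the tails, functions of the noise on DISJOINT input index sets, hence independent
under `Measure.infinitePi`. -/
theorem stub_codedClustering :
    ∀ (G : Type) [Group G] [TopologicalSpace G] [IsTopologicalGroup G] [CompactSpace G]
      [MeasurableSpace G] [BorelSpace G] (r : LatticeRep G) (K : ℝ),
      FmtClustering r (HaarCodedSeq r.ρ K) (1 / 4 : ℝ) 4 :=
  fun G _ _ _ _ _ _ r K A B => HaarCodingEngine.codedClusteringSeq r K A B

/-- stub C2 (COMPOSITION, M–L — provable now, group- and `β`-blind): **a coarse coder at block side `M` (block radius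
`b₁`) and a conditional coder below `M` (block radius `b₂`) compose to a Haar coder at radius `c·M`**, with `K, c`
depending on `K₁, K₂, b₁, b₂` ONLY.  Proof plan: feed the even sub-sequence of the noise to the coarse stage and the
odd one to the conditional stage (independent halves, each again a sequence noise: `Measure.infinitePi` under an index
bijection); the law identity is the composition of the two push-forward identities; locality: the coarse output is
a.s. block-constant (its law is that of `blockField`), so the conditional stage's input window of `k b₂` blocks meets
`≤ 4(2kb₂+2)⁴` blocks, each coded off mass `K₁e^{-k}` within `k b₁` further blocks — union bound, radius
`k·M(b₁+b₂)`, tails `(K₂ + 4K₁(2kb₂+2)⁴)e^{-k}`, re-indexed `k ↦ 2k` to restore `K e^{-k}` with `c = 2(b₁+b₂+1)`. -/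
theorem stub_composeCoders :
    ∀ (K₁ K₂ : ℝ) (b₁ b₂ : ℕ), ∃ (K : ℝ) (c : ℕ), 1 ≤ c ∧
      ∀ (G : Type) [Group G] [TopologicalSpace G] [IsTopologicalGroup G] [CompactSpace G]
        [MeasurableSpace G] [BorelSpace G] {N : ℕ} (ρ : G →* Matrix (Fin N) (Fin N) ℂ) (β : ℝ) (M : ℕ),
        1 ≤ M → CoarseCodedSeq ρ K₁ β M b₁ → CondCodedSeq ρ K₂ β M b₂ → HaarCodedSeq ρ K β (c * M) :=
  composeCoders_holds

/-- stub T (CLUSTER REGION, research XL — the infrared end of the wall W_IR, in coding currency): **for every compact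
simple `G` and lattice representation, for all large `β`, the block-holonomy field at SOME dyadic block side `2^j` is coded
with `O(1)`-block radius `b₁` and one tail constant `K₁`** — «the effective theory at the confinement scale is disordered»,
stated Hamiltonian-free (no renormalised action, no Gibbsianity of the RG image) and unpinned (the pin is X's job through the
PROVED `fmtOnset_pinned`).  Dyadic scales lose at most a factor `2` (a `2M`-block line is the product of two `M`-block
lines of the same partition, so codedness propagates UP the dyadic scales with `b₁ ↦ b₁ + 1`). -/
theorem stub_clusterRegionCoder :
    ∀ (G : Type) [Group G] [TopologicalSpace G] [IsTopologicalGroup G] [CompactSpace G],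
      IsCompactSimpleLieGroup G →
      letI : MeasurableSpace G := borel G
      haveI : BorelSpace G := ⟨rfl⟩
      ∀ (r : LatticeRep G), ∃ (K₁ : ℝ) (b₁ : ℕ) (β₂ : ℝ), ∀ β : ℝ, β₂ ≤ β →
        ∃ j : ℕ, CoarseCodedSeq r.ρ K₁ β (2 ^ j) b₁ := by
  sorry

/-- stub U_UV (DEEP SMALL FIELD, research L–XL, CONDITIONAL — the half of crit-1's split WITH a supplier class): **there is
a number of octaves `λ = λ(G, r, K₁, b₁)` such that, for all large `β`, the fine field GIVEN its `2^{j'}`-block holonomies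
is coded at radius `O(2^{j'})` (constants `K₃, b₃`) for every dyadic scale `j'` at least `λ` octaves BELOW the minimal coded
scale `j⋆(β)`** (and, trivially, for `j' = 0`, where the blocks are the links).  Since `2^{j⋆} ≍ ξ(β)/b₁` and
`ξ/2^{j'} ≥ b₁ 2^{λ}` is a FIXED large ratio, the running coupling at scale `2^{j'}` is at most a fixed small `g⋆(λ)`: these
are exactly Bałaban's small-field scales, and the statement is the CONDITIONAL (fine-given-block-averages) form of his
small-field effective-action control — constrained fluctuation measures with block-scale propagator decay (tree:
`Balaban1983to89/B4ContourShift.latticeKernel_decay`, `B4Eq19LatticeHarmonicDecay.harmonic_decay`, `B3Eq122TorusPropagators`)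
and positive small-field Hessians (`B11HessianL2`, `B12Eq439WilsonHessian`), near-log-concave in the small-field chart ⇒
local (Lipschitz) conditional transport (Caffarelli ∕ Kim–Milman, run in the chart scale by scale), large fields as the
coding's exceptional events (`e^{-c/g(2^{j'})²}` per block).  The unprinted step is the transport, not the estimates. -/
theorem stub_deepSmallFieldCondCoder :
    ∀ (G : Type) [Group G] [TopologicalSpace G] [IsTopologicalGroup G] [CompactSpace G],
      IsCompactSimpleLieGroup G →
      letI : MeasurableSpace G := borel G
      haveI : BorelSpace G := ⟨rfl⟩
      ∀ (r : LatticeRep G) (K₁ : ℝ) (b₁ : ℕ), ∃ (lam : ℕ) (K₃ : ℝ) (b₃ : ℕ) (β₃ : ℝ), ∀ β : ℝ, β₃ ≤ β →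
        ∀ j' : ℕ, (j' + lam ≤ jStar r.ρ K₁ b₁ β ∨ j' = 0) → CondCodedSeq r.ρ K₃ β (2 ^ j') b₃ := by
  sorry

/-- stub U_× (CROSSOVER, research XL, CONDITIONAL — the half of crit-1's split WITHOUT a supplier: the wall): **for every
`λ`, for all large `β`, the `2^{j'}`-block field GIVEN the `2^{j⋆(β)}`-block field is conditionally coded at radius
`O(2^{j⋆})` (constants `K₄(λ), b₄(λ)`) for every `j'` within `λ` octaves below the minimal coded scale `j⋆(β)`** — the last
`λ` octaves below the confinement scale, where the coupling runs from `g⋆(λ)` to its crossover value: no expansion controls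
them; the only structure offered is that the problem is CONDITIONAL on a disordered (`O(1)`-coded) coarse field and spans a
`β`-INDEPENDENT number of octaves. -/
theorem stub_crossoverCondBlockCoder :
    ∀ (G : Type) [Group G] [TopologicalSpace G] [IsTopologicalGroup G] [CompactSpace G],
      IsCompactSimpleLieGroup G →
      letI : MeasurableSpace G := borel G
      haveI : BorelSpace G := ⟨rfl⟩
      ∀ (r : LatticeRep G) (K₁ : ℝ) (b₁ lam : ℕ), ∃ (K₄ : ℝ) (b₄ : ℕ) (β₄ : ℝ), ∀ β : ℝ, β₄ ≤ β →
        {j : ℕ | CoarseCodedSeq r.ρ K₁ β (2 ^ j) b₁}.Nonempty →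
        ∀ j' : ℕ, j' ≤ jStar r.ρ K₁ b₁ β → jStar r.ρ K₁ b₁ β ≤ j' + lam →
          CondBlockCodedSeq r.ρ K₄ β (2 ^ j') (2 ^ jStar r.ρ K₁ b₁ β) b₄ := by
  sorry

/-- stub C3 (CONDITIONAL COMPOSITION, M–L — provable now, group- and `β`-blind): **along NESTED blocks `M' ∣ M`, a
conditional coder of the `M'`-blocks given the `M`-blocks (block radius `b₄` at scale `M`) followed by a conditional coder
of the fine field given its `M'`-blocks (block radius `b₃` at scale `M'`) is a conditional coder of the fine field given
its `M`-blocks** (block radius `b₂(b₃,b₄)` at scale `M`, tail constant `K₂(K₃,K₄,b₃,b₄)`).  Exactness uses the nesting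
identity `blockField M = F ∘ blockField M'` (`F` = ordered product of the sub-block values; holds on every odd torus because
blocks are truncated, not wrapped); locality as in C2 (independent noise halves, a.s. block-constancy, union bound over
`≤ 4(2k b₃ + 2)⁴` sub-blocks, `k ↦ 2k`). -/
theorem stub_composeCond :
    ∀ (K₃ K₄ : ℝ) (b₃ b₄ : ℕ), ∃ (K₂ : ℝ) (b₂ : ℕ),
      ∀ (G : Type) [Group G] [TopologicalSpace G] [IsTopologicalGroup G] [CompactSpace G]
        [MeasurableSpace G] [BorelSpace G] {N : ℕ} (ρ : G →* Matrix (Fin N) (Fin N) ℂ) (β : ℝ) (M' M : ℕ),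
        1 ≤ M' → M' ∣ M → CondBlockCodedSeq ρ K₄ β M' M b₄ → CondCodedSeq ρ K₃ β M' b₃ →
          CondCodedSeq ρ K₂ β M b₂ := by
  sorry

/-- stub X (UV ∕ CALIBRATION, research L–XL; same shape as `HaarCoding.stub_codedAF`): **asymptotic freedom up to the
coding onset** — the `hX` hypothesis of `AfPincerUc.fmtOnset_pinned` for `P := HaarCodedSeq r.ρ K`.  Kill-world: the
coding twin of `Negative/AfOnsetUcFalseOfLateOnset.KSMInf` (optimal coding radius parametrically above `1/a(β)`). -/
theorem stub_codedAF :
    ∀ (G : Type) [Group G] [TopologicalSpace G] [IsTopologicalGroup G] [CompactSpace G],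
      IsCompactSimpleLieGroup G →
      letI : MeasurableSpace G := borel G
      haveI : BorelSpace G := ⟨rfl⟩
      ∀ (r : LatticeRep G) (K : ℝ) (v : 𝓢(EuclideanSpace ℝ (Fin 4), ℝ)),
        tsupport v ⊆ {y : EuclideanSpace ℝ (Fin 4) | 0 < y 0} →
        ∀ η : ℝ, 0 < η → ∃ T β₁ : ℝ, ∀ β : ℝ, β₁ ≤ β → ∀ s : ℝ, 0 < s →
          T ≤ s * (fmtOnset (HaarCodedSeq r.ρ K) β : ℝ) →
            ∃ᶠ (L : ℕ) in atTop, |Q2 G r β L s (thetaTest 4 v) v| ≤ η := by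
  sorry

/-! ## §2b Typed RUNG (strong coupling — where the format is DECIDED TRUE; not used by `IR_of_stubs`) -/

/-- rung R0 (strong coupling, size L; requested by ym-ir-crit-1): **in a high-noise window `0 ≤ β ≤ β₀(G, r)` the
torus Wilson measures are Haar-coded at a FIXED radius `b₀` with one tail constant** — the cluster-region end of the
lens made literal.  Route: single-link conditional densities w.r.t. Haar lie in `[e^{-cβ}, e^{cβ}]` (minorisation
`≥ e^{-2cβ}·Haar`), so a grand coupling of heat-bath updates driven by the noise resets each link to fresh Haar with
probability `ε(β) → 1`; for `(1-ε)·(2(d-1)·4+1) < 1` disagreement paths are subcritical and coupling-from-the-past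
coalesces with exponential tails (Häggström–Steif, Combin. Probab. Comput. 9 (2000); van den Berg–Steif, Ann. Probab.
27 (1999)); the same contraction is the tree's one-link Dobrushin∕KR window (`shen_zhu_zhu_of_dobrushinCondition`,
`su2_latticeMassGap_of_oneLinkKRModulusSU2`).  The sequence alphabet supplies the unbounded
randomness CFTP needs directly (no Borel-isomorphism step), so here the rung is M–L; consequently `CoarseCodedSeq r.ρ K β 1 b₀`
(blocks of side 1 are links) in the same window. -/
theorem rung_strongCouplingCoder :
    ∀ (G : Type) [Group G] [TopologicalSpace G] [IsTopologicalGroup G] [CompactSpace G],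
      IsCompactSimpleLieGroup G →
      letI : MeasurableSpace G := borel G
      haveI : BorelSpace G := ⟨rfl⟩
      ∀ (r : LatticeRep G), ∃ (K β₀ : ℝ) (b₀ : ℕ), 0 < β₀ ∧ 1 ≤ b₀ ∧
        ∀ β : ℝ, 0 ≤ β → β ≤ β₀ → HaarCodedSeq r.ρ K β b₀ := by
  sorry

/-! ## §3 The kernel-checked composition -/

/-- **`E → C2 → C3 → T → U_UV → U_× → X → IRCal`** (real proof; `AfPincerUc.IRCal` is the body of `BalabanLadder.IR`
verbatim).  Per group and representation: T makes the set of coded dyadic scales non-empty for `β ≥ β₂`, so the minimal one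
`j⋆(β)` is coded (`Nat.sInf_mem`); with `j' := j⋆ − λ` (truncated), U_UV codes the fine field given the `2^{j'}`-blocks,
U_× codes the `2^{j'}`-blocks given the `2^{j⋆}`-blocks, C3 composes them into a conditional coder given the `2^{j⋆}`-blocks,
C2 composes that with T's coarse coder into a Haar coder at radius `c·2^{j⋆}` — so `fmtSet (HaarCodedSeq r.ρ K) β` is
non-empty for all large `β` — and the generic pincer (`fmtOnset_pinned` ⊕ `gapInUnits_of_fmtOnset`) concludes. -/
theorem irCal_of_telescoped
    (hE : ∀ (G : Type) [Group G] [TopologicalSpace G] [IsTopologicalGroup G] [CompactSpace G]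
      [MeasurableSpace G] [BorelSpace G] (r : LatticeRep G) (K : ℝ),
      FmtClustering r (HaarCodedSeq r.ρ K) (1 / 4 : ℝ) 4)
    (hC2 : ∀ (K₁ K₂ : ℝ) (b₁ b₂ : ℕ), ∃ (K : ℝ) (c : ℕ), 1 ≤ c ∧
      ∀ (G : Type) [Group G] [TopologicalSpace G] [IsTopologicalGroup G] [CompactSpace G]
        [MeasurableSpace G] [BorelSpace G] {N : ℕ} (ρ : G →* Matrix (Fin N) (Fin N) ℂ) (β : ℝ) (M : ℕ),
        1 ≤ M → CoarseCodedSeq ρ K₁ β M b₁ → CondCodedSeq ρ K₂ β M b₂ → HaarCodedSeq ρ K β (c * M))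
    (hC3 : ∀ (K₃ K₄ : ℝ) (b₃ b₄ : ℕ), ∃ (K₂ : ℝ) (b₂ : ℕ),
      ∀ (G : Type) [Group G] [TopologicalSpace G] [IsTopologicalGroup G] [CompactSpace G]
        [MeasurableSpace G] [BorelSpace G] {N : ℕ} (ρ : G →* Matrix (Fin N) (Fin N) ℂ) (β : ℝ) (M' M : ℕ),
        1 ≤ M' → M' ∣ M → CondBlockCodedSeq ρ K₄ β M' M b₄ → CondCodedSeq ρ K₃ β M' b₃ →
          CondCodedSeq ρ K₂ β M b₂)
    (hT : ∀ (G : Type) [Group G] [TopologicalSpace G] [IsTopologicalGroup G] [CompactSpace G],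
      IsCompactSimpleLieGroup G →
      letI : MeasurableSpace G := borel G; haveI : BorelSpace G := ⟨rfl⟩;
      ∀ (r : LatticeRep G), ∃ (K₁ : ℝ) (b₁ : ℕ) (β₂ : ℝ), ∀ β : ℝ, β₂ ≤ β →
        ∃ j : ℕ, CoarseCodedSeq r.ρ K₁ β (2 ^ j) b₁)
    (hUV : ∀ (G : Type) [Group G] [TopologicalSpace G] [IsTopologicalGroup G] [CompactSpace G],
      IsCompactSimpleLieGroup G →
      letI : MeasurableSpace G := borel G; haveI : BorelSpace G := ⟨rfl⟩;
      ∀ (r : LatticeRep G) (K₁ : ℝ) (b₁ : ℕ), ∃ (lam : ℕ) (K₃ : ℝ) (b₃ : ℕ) (β₃ : ℝ), ∀ β : ℝ, β₃ ≤ β →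
        ∀ j' : ℕ, (j' + lam ≤ jStar r.ρ K₁ b₁ β ∨ j' = 0) → CondCodedSeq r.ρ K₃ β (2 ^ j') b₃)
    (hX4 : ∀ (G : Type) [Group G] [TopologicalSpace G] [IsTopologicalGroup G] [CompactSpace G],
      IsCompactSimpleLieGroup G →
      letI : MeasurableSpace G := borel G; haveI : BorelSpace G := ⟨rfl⟩;
      ∀ (r : LatticeRep G) (K₁ : ℝ) (b₁ lam : ℕ), ∃ (K₄ : ℝ) (b₄ : ℕ) (β₄ : ℝ), ∀ β : ℝ, β₄ ≤ β →
        {j : ℕ | CoarseCodedSeq r.ρ K₁ β (2 ^ j) b₁}.Nonempty →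
        ∀ j' : ℕ, j' ≤ jStar r.ρ K₁ b₁ β → jStar r.ρ K₁ b₁ β ≤ j' + lam →
          CondBlockCodedSeq r.ρ K₄ β (2 ^ j') (2 ^ jStar r.ρ K₁ b₁ β) b₄)
    (hX : ∀ (G : Type) [Group G] [TopologicalSpace G] [IsTopologicalGroup G] [CompactSpace G],
      IsCompactSimpleLieGroup G →
      letI : MeasurableSpace G := borel G; haveI : BorelSpace G := ⟨rfl⟩;
      ∀ (r : LatticeRep G) (K : ℝ) (v : 𝓢(EuclideanSpace ℝ (Fin 4), ℝ)),
        tsupport v ⊆ {y : EuclideanSpace ℝ (Fin 4) | 0 < y 0} →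
        ∀ η : ℝ, 0 < η → ∃ T β₁ : ℝ, ∀ β : ℝ, β₁ ≤ β → ∀ s : ℝ, 0 < s →
          T ≤ s * (fmtOnset (HaarCodedSeq r.ρ K) β : ℝ) →
            ∃ᶠ (L : ℕ) in atTop, |Q2 G r β L s (thetaTest 4 v) v| ≤ η) :
    Summit.QuantumFields.YangMills.Cruxes.IR.AfPincerUc.IRCal := by
  intro G _ _ _ _ hG
  letI : MeasurableSpace G := borel G
  haveI : BorelSpace G := ⟨rfl⟩
  intro r a ha _ hlb
  obtain ⟨K₁, b₁, β₂, hT'⟩ := hT G hG r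
  obtain ⟨lam, K₃, b₃, β₃, hUV'⟩ := hUV G hG r K₁ b₁
  obtain ⟨K₄, b₄, β₄, hX4'⟩ := hX4 G hG r K₁ b₁ lam
  obtain ⟨K₂, b₂, hcomp3⟩ := hC3 K₃ K₄ b₃ b₄
  obtain ⟨K, c, hc, hcomp2⟩ := hC2 K₁ K₂ b₁ b₂
  have hon : ∀ β : ℝ, max β₂ (max β₃ β₄) ≤ β → (fmtSet (HaarCodedSeq r.ρ K) β).Nonempty := by
    intro β hβ
    have hβ₂ : β₂ ≤ β := (le_max_left _ _).trans hβ
    have hβ₃ : β₃ ≤ β := ((le_max_left _ _).trans (le_max_right _ _)).trans hβ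
    have hβ₄ : β₄ ≤ β := ((le_max_right _ _).trans (le_max_right _ _)).trans hβ
    -- the set of coded dyadic scales is non-empty, so its infimum `j⋆` is coded
    have hne : {j : ℕ | CoarseCodedSeq r.ρ K₁ β (2 ^ j) b₁}.Nonempty := hT' β hβ₂
    set js : ℕ := jStar r.ρ K₁ b₁ β with hjs
    have hco : CoarseCodedSeq r.ρ K₁ β (2 ^ js) b₁ := by
      have h := Nat.sInf_mem hne
      simpa [hjs, jStar] using h
    -- the scale `λ` octaves below (truncated at 0)
    set j' : ℕ := js - lam with hj'
    have hsplit : j' + lam ≤ js ∨ j' = 0 := by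
      by_cases h : lam ≤ js
      · exact Or.inl (by rw [hj', Nat.sub_add_cancel h])
      · exact Or.inr (by rw [hj']; exact Nat.sub_eq_zero_of_le (Nat.le_of_not_le h))
    have hcd : CondCodedSeq r.ρ K₃ β (2 ^ j') b₃ := hUV' β hβ₃ j' hsplit
    have hle : j' ≤ js := Nat.sub_le _ _
    have hge : js ≤ j' + lam := by rw [hj']; exact le_tsub_add
    have hcb : CondBlockCodedSeq r.ρ K₄ β (2 ^ j') (2 ^ js) b₄ := hX4' β hβ₄ hne j' hle hge
    have hM' : 1 ≤ 2 ^ j' := Nat.one_le_two_pow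
    have hdvd : 2 ^ j' ∣ 2 ^ js := pow_dvd_pow 2 hle
    have hcond : CondCodedSeq r.ρ K₂ β (2 ^ js) b₂ := hcomp3 G r.ρ β (2 ^ j') (2 ^ js) hM' hdvd hcb hcd
    have hM : 1 ≤ 2 ^ js := Nat.one_le_two_pow
    have hcM : 1 ≤ c * 2 ^ js := by simpa using Nat.mul_le_mul hc hM
    exact ⟨c * 2 ^ js, hcM, hcomp2 G r.ρ β (2 ^ js) hM hco hcond⟩
  have hcl : FmtClustering r (HaarCodedSeq r.ρ K) (1 / 4 : ℝ) 4 := hE G r K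
  obtain ⟨T, β₆, hpin⟩ := fmtOnset_pinned (HaarCodedSeq r.ρ K) r a ha hlb (hX G hG r K)
  exact gapInUnits_of_fmtOnset r a ha (by norm_num) hcl hon hpin

/-- **The route decl BY NAME from the seven named stubs** (`sorry` only inside the stubs). -/
theorem IR_of_stubs : Summit.QuantumFields.YangMills.Theses.BalabanLadder.IR := by
  have h : Summit.QuantumFields.YangMills.Cruxes.IR.AfPincerUc.IRCal :=
    irCal_of_telescoped stub_codedClustering stub_composeCoders stub_composeCond stub_clusterRegionCoder
      stub_deepSmallFieldCondCoder stub_crossoverCondBlockCoder stub_codedAF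
  delta Summit.QuantumFields.YangMills.Theses.BalabanLadder.IR
  delta Summit.QuantumFields.YangMills.Cruxes.IR.AfPincerUc.IRCal at h
  exact h

end Summit.QuantumFields.YangMills.Cruxes.IR.TelescopedCoding

end
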